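import Mathlib.Analysis.SpecialFunctions.Integrals.Basic
import Mathlib.Analysis.Complex.Exponential
import Mathlib.MeasureTheory.Integral.DominatedConvergence
import HarnessLib

/-!
# The SU(3) one-plaquette integral in Weyl-torus form; Fourier modes on the torus

HONEST FRAMING: exact (Metropolis-corrected) sampling algorithms for lattice gauge theory;
figures of merit are autocorrelation/cost numbers at stated couplings and volumes; no
continuum-physics claim.

Venture `LatticeQCDFlow` (cell pub-lqcd), sub-topic `Scoring`; FANOUT row 5 (`s0-sun-a`, S0-C
implementation A — the 'exact 2-d plaquette oracle' column).  NEW WORK of the cell (placement rule).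
`Scoring/OnePlaquetteEnclosures.lean` encloses the U(1) and SU(2) one-plaquette plaquettes at the
reference-table couplings and lists the SU(3) keys as NOT typed ('a two-angle class integral').  This
file and `Scoring/OnePlaquetteSU3Moments.lean` supply the analytic half for SU(3); the rational
certificates and the three enclosures (`β = 4, 5, 6`) are in `Scoring/OnePlaquetteSU3Enclosures.lean`.

* `onePlaquetteExpectSU3 β f` — the SU(3) one-plaquette expectation in Weyl-torus form: class angles
  `(θ₁, θ₂)` (`θ₃ = −θ₁−θ₂`), density `|Δ|² e^{(β/3) Re tr U}` on `[0,2π]²` (iterated interval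
  integrals) with `|Δ|² = Π_{i<j} |e^{iθ_i} − e^{iθ_j}|²` (`weylSU3`) and
  `Re tr U = cos θ₁ + cos θ₂ + cos(θ₁+θ₂)` (`reTrSU3`); the plaquette observable is
  `plaqSU3 = (1/3) Re tr U`.  Weyl's integration formula and the 2-d gauge-fixing reduction to
  independent plaquettes are NOT typed — this Weyl-torus integral is the DEFINITION the enclosures are
  about, the same convention as `onePlaquetteExpect` / `onePlaquetteExpectSU2`.
* A toolkit for iterated integrals `∫_a^b ∫_c^d` of jointly continuous integrands (additivity, finite
  sums, constants, norm bound by a continuous majorant).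
* Torus Fourier modes `torusMode m n θ₁ θ₂ = e^{i(mθ₁+nθ₂)}`, their algebra, `cos` in terms of them, and
  **Fourier orthogonality** `∫_0^{2π}∫_0^{2π} e^{i(mθ₁+nθ₂)} = (2π)² [m = n = 0]` (`integral2_torusMode`).
-/

namespace Summit.Ventures.LatticeQCDFlow.Scoring

open MeasureTheory intervalIntegral Finset
open scoped Real Nat

/-! ### 1. Definitions -/

/-- `Re tr U` on the maximal torus of `SU(3)`, `U = diag(e^{iθ₁}, e^{iθ₂}, e^{−i(θ₁+θ₂)})`. -/
noncomputable def reTrSU3 (θ₁ θ₂ : ℝ) : ℝ := Real.cos θ₁ + Real.cos θ₂ + Real.cos (θ₁ + θ₂)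

/-- The Weyl density `|Δ(U)|² = Π_{i<j} |e^{iθ_i} − e^{iθ_j}|²` on the maximal torus of `SU(3)`
(`θ₃ = −θ₁−θ₂`, `|e^{iφ} − e^{iψ}|² = 2 − 2 cos(φ − ψ)`; the differences are `θ₁−θ₂`, `2θ₁+θ₂`, `θ₁+2θ₂`). -/
noncomputable def weylSU3 (θ₁ θ₂ : ℝ) : ℝ :=
  (2 - 2 * Real.cos (θ₁ - θ₂)) * (2 - 2 * Real.cos (2 * θ₁ + θ₂)) * (2 - 2 * Real.cos (θ₁ + 2 * θ₂))

/-- The SU(3) one-plaquette partition function in Weyl-torus form,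
`Z₃(β) = ∫_0^{2π} ∫_0^{2π} |Δ|² e^{(β/3) Re tr U} dθ₂ dθ₁` (the Weyl normalisation `1/(6(2π)²)` cancels in
expectations). -/
noncomputable def onePlaquetteZSU3 (β : ℝ) : ℝ :=
  ∫ θ₁ in (0 : ℝ)..2 * π, ∫ θ₂ in (0 : ℝ)..2 * π, weylSU3 θ₁ θ₂ * Real.exp (β / 3 * reTrSU3 θ₁ θ₂)

/-- The SU(3) one-plaquette expectation of a class function `f(θ₁, θ₂)` under the Wilson weight
`e^{(β/3) Re tr U}`: `⟨f⟩ = (1/Z₃) ∫∫ f |Δ|² e^{(β/3) Re tr U}`. -/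
noncomputable def onePlaquetteExpectSU3 (β : ℝ) (f : ℝ → ℝ → ℝ) : ℝ :=
  (∫ θ₁ in (0 : ℝ)..2 * π, ∫ θ₂ in (0 : ℝ)..2 * π,
      f θ₁ θ₂ * (weylSU3 θ₁ θ₂ * Real.exp (β / 3 * reTrSU3 θ₁ θ₂))) / onePlaquetteZSU3 β

/-- The plaquette observable `(1/3) Re tr U_p`. -/
noncomputable def plaqSU3 (θ₁ θ₂ : ℝ) : ℝ := reTrSU3 θ₁ θ₂ / 3

/-- `reTrSU3` is jointly continuous (compositional form for `fun_prop`). -/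
@[fun_prop]
theorem continuous_reTrSU3_comp {X : Type*} [TopologicalSpace X] {f g : X → ℝ}
    (hf : Continuous f) (hg : Continuous g) : Continuous fun x => reTrSU3 (f x) (g x) := by
  unfold reTrSU3; fun_prop

/-- `weylSU3` is jointly continuous (compositional form for `fun_prop`). -/
@[fun_prop]
theorem continuous_weylSU3_comp {X : Type*} [TopologicalSpace X] {f g : X → ℝ}
    (hf : Continuous f) (hg : Continuous g) : Continuous fun x => weylSU3 (f x) (g x) := by
  unfold weylSU3; fun_prop

/-- `plaqSU3` is jointly continuous (compositional form for `fun_prop`). -/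
@[fun_prop]
theorem continuous_plaqSU3_comp {X : Type*} [TopologicalSpace X] {f g : X → ℝ}
    (hf : Continuous f) (hg : Continuous g) : Continuous fun x => plaqSU3 (f x) (g x) := by
  unfold plaqSU3; fun_prop

/-- `|Δ|² ≥ 0`. -/
theorem weylSU3_nonneg (θ₁ θ₂ : ℝ) : 0 ≤ weylSU3 θ₁ θ₂ := by
  unfold weylSU3
  have h1 := Real.cos_le_one (θ₁ - θ₂)
  have h2 := Real.cos_le_one (2 * θ₁ + θ₂)
  have h3 := Real.cos_le_one (θ₁ + 2 * θ₂)
  have : 0 ≤ 2 - 2 * Real.cos (θ₁ - θ₂) := by linarith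
  have : 0 ≤ 2 - 2 * Real.cos (2 * θ₁ + θ₂) := by linarith
  have : 0 ≤ 2 - 2 * Real.cos (θ₁ + 2 * θ₂) := by linarith
  positivity

/-- `|Re tr U| ≤ 3`. -/
theorem abs_reTrSU3_le (θ₁ θ₂ : ℝ) : |reTrSU3 θ₁ θ₂| ≤ 3 := by
  unfold reTrSU3
  have h1 := Real.abs_cos_le_one θ₁
  have h2 := Real.abs_cos_le_one θ₂
  have h3 := Real.abs_cos_le_one (θ₁ + θ₂)
  calc |Real.cos θ₁ + Real.cos θ₂ + Real.cos (θ₁ + θ₂)|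
      ≤ |Real.cos θ₁ + Real.cos θ₂| + |Real.cos (θ₁ + θ₂)| := abs_add_le _ _
    _ ≤ |Real.cos θ₁| + |Real.cos θ₂| + |Real.cos (θ₁ + θ₂)| := by gcongr; exact abs_add_le _ _
    _ ≤ 1 + 1 + 1 := by gcongr
    _ = 3 := by norm_num

/-- `|plaqSU3| ≤ 1`. -/
theorem abs_plaqSU3_le (θ₁ θ₂ : ℝ) : |plaqSU3 θ₁ θ₂| ≤ 1 := by
  unfold plaqSU3
  rw [abs_div, abs_of_pos (by norm_num : (0:ℝ) < 3), div_le_one (by norm_num)]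
  exact abs_reTrSU3_le θ₁ θ₂

/-- `|1 + Re tr U| ≤ 4`. -/
theorem abs_one_add_reTrSU3_le (θ₁ θ₂ : ℝ) : |1 + reTrSU3 θ₁ θ₂| ≤ 4 := by
  have h := abs_reTrSU3_le θ₁ θ₂
  calc |1 + reTrSU3 θ₁ θ₂| ≤ |(1:ℝ)| + |reTrSU3 θ₁ θ₂| := abs_add_le _ _
    _ ≤ 1 + 3 := by rw [abs_one]; gcongr
    _ = 4 := by norm_num

/-! ### 2. Iterated integrals over the square: a small toolkit for jointly continuous integrands -/

section Toolkit

variable {E : Type*} [NormedAddCommGroup E]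

/-- Slices of a jointly continuous function are interval integrable. -/
theorem intervalIntegrable_slice {g : ℝ → ℝ → E} (hg : Continuous fun p : ℝ × ℝ => g p.1 p.2)
    (θ₁ c d : ℝ) : IntervalIntegrable (g θ₁) volume c d :=
  (show Continuous (g θ₁) from hg.comp (Continuous.prodMk_right θ₁)).intervalIntegrable c d

variable [NormedSpace ℝ E]

/-- The inner integral of a jointly continuous function is continuous in the outer variable. -/
theorem continuous_inner_integral {g : ℝ → ℝ → E} (hg : Continuous fun p : ℝ × ℝ => g p.1 p.2)
    (c d : ℝ) : Continuous fun θ₁ => ∫ θ₂ in c..d, g θ₁ θ₂ :=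
  intervalIntegral.continuous_parametric_intervalIntegral_of_continuous' hg c d

/-- A pointwise bound by a jointly continuous majorant bounds the iterated integral (`a ≤ b`, `c ≤ d`). -/
theorem norm_integral2_le {g : ℝ → ℝ → E} {B : ℝ → ℝ → ℝ}
    (hB : Continuous fun p : ℝ × ℝ => B p.1 p.2) (hle : ∀ θ₁ θ₂, ‖g θ₁ θ₂‖ ≤ B θ₁ θ₂)
    {a b c d : ℝ} (hab : a ≤ b) (hcd : c ≤ d) :
    ‖∫ θ₁ in a..b, ∫ θ₂ in c..d, g θ₁ θ₂‖ ≤ ∫ θ₁ in a..b, ∫ θ₂ in c..d, B θ₁ θ₂ := by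
  refine intervalIntegral.norm_integral_le_of_norm_le hab
    (Filter.Eventually.of_forall fun θ₁ _ => ?_) ((continuous_inner_integral hB c d).intervalIntegrable a b)
  exact intervalIntegral.norm_integral_le_of_norm_le hcd
    (Filter.Eventually.of_forall fun θ₂ _ => hle θ₁ θ₂) (intervalIntegrable_slice hB θ₁ c d)

/-- Additivity of the iterated integral. -/
theorem integral2_add {g h : ℝ → ℝ → E} (hg : Continuous fun p : ℝ × ℝ => g p.1 p.2)
    (hh : Continuous fun p : ℝ × ℝ => h p.1 p.2) (a b c d : ℝ) :
    (∫ θ₁ in a..b, ∫ θ₂ in c..d, (g θ₁ θ₂ + h θ₁ θ₂))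
      = (∫ θ₁ in a..b, ∫ θ₂ in c..d, g θ₁ θ₂) + ∫ θ₁ in a..b, ∫ θ₂ in c..d, h θ₁ θ₂ := by
  rw [← intervalIntegral.integral_add ((continuous_inner_integral hg c d).intervalIntegrable _ _)
    ((continuous_inner_integral hh c d).intervalIntegrable _ _)]
  exact intervalIntegral.integral_congr fun θ₁ _ =>
    intervalIntegral.integral_add (intervalIntegrable_slice hg θ₁ c d) (intervalIntegrable_slice hh θ₁ c d)

/-- Subtractivity of the iterated integral. -/
theorem integral2_sub {g h : ℝ → ℝ → E} (hg : Continuous fun p : ℝ × ℝ => g p.1 p.2)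
    (hh : Continuous fun p : ℝ × ℝ => h p.1 p.2) (a b c d : ℝ) :
    (∫ θ₁ in a..b, ∫ θ₂ in c..d, (g θ₁ θ₂ - h θ₁ θ₂))
      = (∫ θ₁ in a..b, ∫ θ₂ in c..d, g θ₁ θ₂) - ∫ θ₁ in a..b, ∫ θ₂ in c..d, h θ₁ θ₂ := by
  rw [← intervalIntegral.integral_sub ((continuous_inner_integral hg c d).intervalIntegrable _ _)
    ((continuous_inner_integral hh c d).intervalIntegrable _ _)]
  exact intervalIntegral.integral_congr fun θ₁ _ =>
    intervalIntegral.integral_sub (intervalIntegrable_slice hg θ₁ c d) (intervalIntegrable_slice hh θ₁ c d)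

/-- Finite sums come out of the iterated integral. -/
theorem integral2_finset_sum {ι : Type*} (s : Finset ι) {g : ι → ℝ → ℝ → E}
    (hg : ∀ i ∈ s, Continuous fun p : ℝ × ℝ => g i p.1 p.2) (a b c d : ℝ) :
    (∫ θ₁ in a..b, ∫ θ₂ in c..d, ∑ i ∈ s, g i θ₁ θ₂)
      = ∑ i ∈ s, ∫ θ₁ in a..b, ∫ θ₂ in c..d, g i θ₁ θ₂ := by
  have h1 : ∀ θ₁, (∫ θ₂ in c..d, ∑ i ∈ s, g i θ₁ θ₂) = ∑ i ∈ s, ∫ θ₂ in c..d, g i θ₁ θ₂ :=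
    fun θ₁ => intervalIntegral.integral_finsetSum fun i hi => intervalIntegrable_slice (hg i hi) θ₁ c d
  simp_rw [h1]
  exact intervalIntegral.integral_finsetSum fun i hi =>
    (continuous_inner_integral (hg i hi) c d).intervalIntegrable a b

end Toolkit

/-- Constants come out of the iterated integral. -/
theorem integral2_const_mul {𝕜 : Type*} [NormedDivisionRing 𝕜] [NormedAlgebra ℝ 𝕜]
    (r : 𝕜) (g : ℝ → ℝ → 𝕜) (a b c d : ℝ) :
    (∫ θ₁ in a..b, ∫ θ₂ in c..d, r * g θ₁ θ₂) = r * ∫ θ₁ in a..b, ∫ θ₂ in c..d, g θ₁ θ₂ := by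
  rw [← intervalIntegral.integral_const_mul]
  exact intervalIntegral.integral_congr fun θ₁ _ => intervalIntegral.integral_const_mul r _

/-! ### 3. Fourier modes on the torus and their integrals -/

/-- The torus Fourier mode `e^{i(mθ₁ + nθ₂)}`. -/
noncomputable def torusMode (m n : ℤ) (θ₁ θ₂ : ℝ) : ℂ :=
  Complex.exp (((m : ℂ) * θ₁ + (n : ℂ) * θ₂) * Complex.I)

/-- `torusMode m n` is jointly continuous (compositional form for `fun_prop`). -/
@[fun_prop]
theorem continuous_torusMode_comp {X : Type*} [TopologicalSpace X] {f g : X → ℝ}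
    (hf : Continuous f) (hg : Continuous g) (m n : ℤ) :
    Continuous fun x => torusMode m n (f x) (g x) := by
  unfold torusMode; fun_prop

/-- `e^{i(mθ₁+nθ₂)} e^{i(m'θ₁+n'θ₂)} = e^{i((m+m')θ₁+(n+n')θ₂)}`. -/
theorem torusMode_mul (m n m' n' : ℤ) (θ₁ θ₂ : ℝ) :
    torusMode m n θ₁ θ₂ * torusMode m' n' θ₁ θ₂ = torusMode (m + m') (n + n') θ₁ θ₂ := by
  unfold torusMode
  rw [← Complex.exp_add]
  congr 1
  push_cast
  ring

/-- `(e^{i(mθ₁+nθ₂)})^p = e^{i(pmθ₁+pnθ₂)}`. -/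
theorem torusMode_pow (m n : ℤ) (p : ℕ) (θ₁ θ₂ : ℝ) :
    torusMode m n θ₁ θ₂ ^ p = torusMode (p * m) (p * n) θ₁ θ₂ := by
  unfold torusMode
  rw [← Complex.exp_nat_mul]
  congr 1
  push_cast
  ring

/-- `e^{i(mθ₁+nθ₂)} = u^m w^n` with `u = e^{iθ₁}`, `w = e^{iθ₂}`. -/
theorem torusMode_eq_zpow (m n : ℤ) (θ₁ θ₂ : ℝ) :
    torusMode m n θ₁ θ₂
      = Complex.exp ((θ₁ : ℂ) * Complex.I) ^ m * Complex.exp ((θ₂ : ℂ) * Complex.I) ^ n := by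
  unfold torusMode
  rw [show ((m : ℂ) * θ₁ + (n : ℂ) * θ₂) * Complex.I
      = (m : ℂ) * ((θ₁ : ℂ) * Complex.I) + (n : ℂ) * ((θ₂ : ℂ) * Complex.I) by ring,
    Complex.exp_add, Complex.exp_int_mul, Complex.exp_int_mul]

/-- `cos x = (e^{ix} + (e^{ix})⁻¹)/2` as a complex number. -/
theorem ofReal_cos_eq (x : ℝ) :
    ((Real.cos x : ℝ) : ℂ) = (Complex.exp ((x : ℂ) * Complex.I) + (Complex.exp ((x : ℂ) * Complex.I))⁻¹) / 2 := by
  rw [Complex.ofReal_cos, ← Complex.exp_neg, ← neg_mul, ← Complex.two_cos]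
  ring

/-- **Fourier orthogonality on the circle**: `∫_0^{2π} e^{inθ} dθ = 2π` if `n = 0`, else `0`. -/
theorem integral_cexp_int_mul_I (n : ℤ) :
    (∫ θ in (0 : ℝ)..2 * π, Complex.exp ((n : ℂ) * θ * Complex.I))
      = if n = 0 then 2 * (π : ℂ) else 0 := by
  split_ifs with hn
  · subst hn
    simp
  · have hc : (n : ℂ) * Complex.I ≠ 0 := mul_ne_zero (by exact_mod_cast hn) Complex.I_ne_zero
    have hfun : (fun θ : ℝ => Complex.exp ((n : ℂ) * θ * Complex.I))
        = fun θ : ℝ => Complex.exp ((n : ℂ) * Complex.I * θ) := by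
      funext θ; ring_nf
    rw [hfun, integral_exp_mul_complex hc]
    have h2 : Complex.exp ((n : ℂ) * Complex.I * ↑(2 * π)) = 1 := by
      rw [← Complex.exp_int_mul_two_pi_mul_I n]
      congr 1
      push_cast
      ring
    rw [h2]
    simp

/-- **Fourier orthogonality on the torus**: `∫_0^{2π}∫_0^{2π} e^{i(mθ₁+nθ₂)} = (2π)²` if `m = n = 0`,
else `0`. -/
theorem integral2_torusMode (m n : ℤ) :
    (∫ θ₁ in (0 : ℝ)..2 * π, ∫ θ₂ in (0 : ℝ)..2 * π, torusMode m n θ₁ θ₂)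
      = if m = 0 ∧ n = 0 then (2 * (π : ℂ)) ^ 2 else 0 := by
  have hsplit : ∀ θ₁ θ₂ : ℝ, torusMode m n θ₁ θ₂
      = Complex.exp ((m : ℂ) * θ₁ * Complex.I) * Complex.exp ((n : ℂ) * θ₂ * Complex.I) := by
    intro θ₁ θ₂
    unfold torusMode
    rw [← Complex.exp_add]
    congr 1
    ring
  simp_rw [hsplit]
  have hinner : ∀ θ₁ : ℝ,
      (∫ θ₂ in (0 : ℝ)..2 * π, Complex.exp ((m : ℂ) * θ₁ * Complex.I) * Complex.exp ((n : ℂ) * θ₂ * Complex.I))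
        = Complex.exp ((m : ℂ) * θ₁ * Complex.I) * (if n = 0 then 2 * (π : ℂ) else 0) := fun θ₁ => by
    rw [intervalIntegral.integral_const_mul, integral_cexp_int_mul_I]
  simp_rw [hinner]
  rw [intervalIntegral.integral_mul_const, integral_cexp_int_mul_I]
  by_cases hm : m = 0 <;> by_cases hn : n = 0 <;> simp [hm, hn, sq]

end Summit.Ventures.LatticeQCDFlow.Scoring
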